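import Summits.Langlands.Langlands.Theses.HeptagonalTower
import Literature.FieldTheory.AlgClosed.PadicAlgClEquivComplex
import HarnessLib

/-!
# STRATEGY CENSUS sketch — `HeptagonalTower.SectorComplement` (ledger item stmt-Langlands-2175, HOMONYM:
the id is shared with `AdjointEulerNumerical.Assembly` and `SqrtFiveQuarticCovers.SectorComplement`; this
file concerns ONLY the HeptagonalTower rendering `SectorComplement := Target → _root_.Langlands`).

crux-strategist `cstrat-stmt-Langlands-2175-s1`, 2026-08-17.  Kernel-checked content of STRATEGY-CENSUS.md:

* §0 position: `Langlands → C`, `C → Target → Langlands`, `¬C ↔ Target ∧ ¬Langlands`, `Assembly` (the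
  route's OTHER item literally named `Assembly`, stmt-Langlands-16843) holds by pure logic, and under the
  four real cruxes `C ↔ Langlands`;
* §1 STRENGTHEN: the inductive-in-`n` strengthening `LanglandsInductive` is EQUIVALENT to the summit
  (`langlands_iff_inductive`), so its rigidity buys nothing; `S⁺ := Langlands` gives `C` trivially;
* §2 DECOMPOSITION D_HT: the summit's typed partition (route PrimeSwitchSplit rev 3, re-typed `∀ 𝓡`:
  B_w, W⁺, P, L∤∀, RD, U → Langlands; texts only, proof adapted from the published
  `Cruxes/SectorComplement/Lines/RamifiedCoefficientSeedSectorComplementOfLeaves.lean`) with B_w CUT ALONG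
  THE ROUTE'S OWN PLANE — irreducible pinned-geometric 2-dimensional `ρ`
  over a totally real field of the real 7-cyclotomic tower whose arithmetic-Frobenius polynomials are
  `X² − a_w(E) X + q_w` for an elliptic curve `E` (the `V_ℓ E`-plane, cut EXTRINSICALLY since the tree has
  no Tate-module object) — so that `Target` is load-bearing in exactly one piece, the dictionary leaf
  `EllipticPlaneEntry` (B⁺_E); glue `sectorComplement_of_pieces` PROVED (pure logic: excluded middle on the
  plane, the prime switch at `v ∣ ℓ` through `ℓ' ∈ {2, 3}`, per-`𝓡` assembly of (A) and (B));
* (§2bis, cited only: D_R = Henniart rigidity + the `∃ 𝓡` junction, landed as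
  `ReciprocityRigidity.langlands_iff_exists_of_rigid` in Theorems/DyadicOddResidueSectorComplementRigidityTransport
  — that module and the IBS seam `SectorComplementSeam.langlands_of_weak_leaves_forall` are not built on the farm
  today, so they are not imported here);
* §3 NEGATION: the content of a counterexample (`not_sectorComplement_iff`).

Nothing here is filed as a line or a split: see STRATEGY-CENSUS.md for why (no leverage on the crux; the
pieces are the summit's own partition, already routed as PrimeSwitchSplit / CompatibleFamilySplit /
IrreducibilityBySelfDuality and registered as lines on the homonymous frames 18275 / 18745 / 12840).
-/

set_option linter.dupNamespace false

noncomputable section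

open scoped NumberField Classical Polynomial
open Filter IsDedekindDomain Polynomial
open Literature.NumberTheory.Automorphic Literature.NumberTheory.GaloisRepresentations
open Summit.Langlands
open Summit.Langlands.Langlands.Theses.HeptagonalTower

namespace Summit.Langlands.Langlands.Cruxes.Assembly.HeptagonalTowerCensus

/-! ## §0 Position of the frame item -/

/-- The frame is implied by the summit. [folklore] -/
theorem sectorComplement_of_langlands : _root_.Langlands → SectorComplement := fun h _ ↦ h

/-- The frame plus the route target IS the summit. [folklore] -/
theorem langlands_of_sectorComplement_of_target (hC : SectorComplement) (hX : Target) :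
    _root_.Langlands := hC hX

/-- Exact content of a refutation of the frame. [folklore] -/
theorem not_sectorComplement_iff : ¬ SectorComplement ↔ Target ∧ ¬ _root_.Langlands :=
  Classical.not_imp

/-- The route's item literally named `Assembly` (stmt-Langlands-16843, the type of `closes`) holds by pure
logic (it is NOT the item this census is about). [folklore] -/
theorem assembly_holds : Assembly := fun hNV hK hD hT hC ↦
  hC (fun K _ _ hK' hemb E hE ↦ hD K hK' hemb (hK hNV K hK' hemb) (hT K hK' hemb) E hE)

/-- Under the route's four real cruxes the frame is literally the summit. [folklore] -/
theorem sectorComplement_iff_langlands_of_cruxes (hNV : NonvanishingSevenTwists) (hK : KatoRankZeroSeven)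
    (hD : OddDegreeDoor) (hT : TorsionSeven) : SectorComplement ↔ _root_.Langlands :=
  ⟨fun hC ↦ closes assembly_holds hNV hK hD hT hC, fun h _ ↦ h⟩

/-! ## §1 STRENGTHEN — the inductive-in-`n` form is the summit again -/

/-- `S_ind`: reciprocity for `GL_n` over `F` relative to `𝓡`, ASSUMING it for all `GL_m`, `0 < m < n`, over the
same `F` and `𝓡` (the shape in which Lafforgue's function-field proof runs: Deligne's recurrence). [folklore] -/
def LanglandsInductive : Prop :=
  ∀ (F : Type) [Field F] [NumberField F],
    Nonempty (ReciprocityData F) ∧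
      ∀ (𝓡 : ReciprocityData F) (n : ℕ), 0 < n →
        (∀ m : ℕ, 0 < m → m < n → ∀ hcpt' : isCompact_glFiniteIntegralLevel m F,
            GlobalLanglandsCorrespondenceGLn m F 𝓡 hcpt') →
        ∀ hcpt : isCompact_glFiniteIntegralLevel n F, GlobalLanglandsCorrespondenceGLn n F 𝓡 hcpt

/-- The inductive strengthening is EQUIVALENT to the summit (strong induction on `n`): its added rigidity —
the inductive hypothesis in ranks `< n` — is available for free, so it cannot make the step easier. [folklore] -/
theorem langlands_iff_inductive : _root_.Langlands ↔ LanglandsInductive := by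
  constructor
  · intro h F _ _
    exact ⟨(h F).1, fun 𝓡 n hn _ hcpt ↦ (h F).2 𝓡 n hn hcpt⟩
  · intro h F _ _
    refine ⟨(h F).1, fun 𝓡 n ↦ ?_⟩
    induction n using Nat.strong_induction_on with
    | _ n ih =>
      intro hn hcpt
      exact (h F).2 𝓡 n hn (fun m hm hmn hcpt' ↦ ih m hmn hm hcpt') hcpt

/-- … hence `S_ind → C` (and `S⁺ := Langlands → C` is `sectorComplement_of_langlands`). [folklore] -/
theorem sectorComplement_of_inductive (h : LanglandsInductive) : SectorComplement :=
  fun _ ↦ langlands_iff_inductive.2 h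

/-! ## §2 DECOMPOSITION D_HT — the `∀ 𝓡` seam with B_w cut along the route's elliptic plane -/

/-- The route's plane inside direction (B), cut EXTRINSICALLY (no Tate-module object in the tree): `n = 2`, `K`
totally real inside some `ℚ(ζ_{7^{m+1}})`, and `ρ` has, at all but finitely many `w`, the arithmetic-Frobenius
polynomial `X² − a_w(E)·X + q_w` of the `ℓ`-adic Tate module `V_ℓ E` of an elliptic curve `E / 𝓞 K`
(`frobTraceAt E w = q_w + 1 − #E(k_w)`). [folklore] -/
def OnEllipticTowerPlane (K : Type) [Field K] [NumberField K] (n : ℕ) (ℓ : ℕ) [Fact ℓ.Prime]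
    (ρ : FramedGaloisRep K (PadicAlgCl ℓ) n) : Prop :=
  n = 2 ∧ NumberField.IsTotallyReal K ∧
    (∃ m : ℕ, Nonempty (K →+* CyclotomicField ((7 : ℕ+) ^ (m + 1)) ℚ)) ∧
    ∃ E : WeierstrassCurve (𝓞 K), E.Δ ≠ 0 ∧
      ∀ᶠ w : HeightOneSpectrum (𝓞 K) in cofinite,
        ρ.HasFrobCharpolyAt w
          (X ^ 2 - C ((frobTraceAt E w : ℤ) : PadicAlgCl ℓ) * X + C ((w.residueCard : ℕ) : PadicAlgCl ℓ))

/-- **B⁺_E — the dictionary leaf (the ONE piece in which `Target` bears load):** the route target (every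
elliptic curve over every totally real field of the real 7-cyclotomic tower is modular in the tree's
`IsModularEllipticCurve` rendering) implies weak automorphy ON the elliptic plane: every irreducible
pinned-geometric `ρ` on the plane is Satake–Frobenius compatible a.e. with an L-algebraic cuspidal `π` of
`GL₂(𝔸_K)`.  True in substance (half-twist `π ⊗ |det|^{1/2}` of the weight-zero `π` of `Target`; central
character pinned by Chebotarev + Brauer–Nesbitt against `V_ℓ E` through the Galois representation of `π`,
Carayol/Taylor/Blasius–Rogawski; CM case by automorphic induction) but a formalisation DEBT of size L: the
Tate-module package and the twist/Satake bookkeeping are not in the tree. [folklore] -/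
def EllipticPlaneEntry : Prop :=
  Target →
    ∀ (K : Type) [Field K] [NumberField K] (n : ℕ) (hcpt : isCompact_glFiniteIntegralLevel n K),
      0 < n → ∀ (ℓ : ℕ) [Fact ℓ.Prime] (ι : PadicAlgCl ℓ ≃+* ℂ) (ρ : FramedGaloisRep K (PadicAlgCl ℓ) n),
        ρ.toGaloisRep.IsIrreducible →
          ((∀ᶠ v : HeightOneSpectrum (𝓞 K) in cofinite, ρ.IsUnramifiedAt v) ∧
            ∀ (v : HeightOneSpectrum (𝓞 K)) (hv : ((ℓ : ℕ) : 𝓞 K) ∈ v.asIdeal),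
              (Literature.NumberTheory.PAdicHodge.fontainePstAdicCompletion v ℓ hv).IsDeRhamFramed
                (ρ.toLocal v)) →
          OnEllipticTowerPlane K n ℓ ρ →
            ∃ π : CuspidalAutomorphicRepData n K hcpt, π.1.IsLAlgebraic ∧
              ∀ᶠ v : HeightOneSpectrum (𝓞 K) in cofinite, SatakeFrobCompatibleAt ι π.1 ρ v

/-- **B⁻ — weak geometric automorphy OFF the elliptic plane** (= `PrimeSwitchSplit.WeakGeometricAutomorphy`,
stmt-Langlands-17414, minus a sliver; the whole open core of direction (B)). [cite: FontaineMazurGeometric1995, Conj. 1] -/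
def WeakAutomorphyOffEllipticPlane : Prop :=
  ∀ (K : Type) [Field K] [NumberField K] (n : ℕ) (hcpt : isCompact_glFiniteIntegralLevel n K),
    0 < n → ∀ (ℓ : ℕ) [Fact ℓ.Prime] (ι : PadicAlgCl ℓ ≃+* ℂ) (ρ : FramedGaloisRep K (PadicAlgCl ℓ) n),
      ρ.toGaloisRep.IsIrreducible →
        ((∀ᶠ v : HeightOneSpectrum (𝓞 K) in cofinite, ρ.IsUnramifiedAt v) ∧
          ∀ (v : HeightOneSpectrum (𝓞 K)) (hv : ((ℓ : ℕ) : 𝓞 K) ∈ v.asIdeal),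
            (Literature.NumberTheory.PAdicHodge.fontainePstAdicCompletion v ℓ hv).IsDeRhamFramed
              (ρ.toLocal v)) →
        ¬ OnEllipticTowerPlane K n ℓ ρ →
          ∃ π : CuspidalAutomorphicRepData n K hcpt, π.1.IsLAlgebraic ∧
            ∀ᶠ v : HeightOneSpectrum (𝓞 K) in cofinite, SatakeFrobCompatibleAt ι π.1 ρ v

/-- **W⁺ — irreducible Satake avatar of every L-algebraic cuspidal `π`** (= `PrimeSwitchSplit.SatakeAvatarExistence`,
stmt-Langlands-17415, verbatim). [cite: BuzzardGeeLMS2014, Conj. 3.2.2] -/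
def SatakeAvatarExistence : Prop :=
  ∀ (K : Type) [Field K] [NumberField K] (n : ℕ) (hcpt : isCompact_glFiniteIntegralLevel n K), 0 < n →
    ∀ (π : CuspidalAutomorphicRepData n K hcpt), π.1.IsLAlgebraic → ∀ (ℓ : ℕ) [Fact ℓ.Prime] (ι : PadicAlgCl ℓ ≃+* ℂ),
      ∃ ρ : FramedGaloisRep K (PadicAlgCl ℓ) n, ρ.toGaloisRep.IsIrreducible ∧
        ∀ᶠ v : HeightOneSpectrum (𝓞 K) in cofinite, SatakeFrobCompatibleAt ι π.1 ρ v

/-- **P — de Rham above `ℓ` + the prime-switch principle** (= `PrimeSwitchSplit.PadicMemberCompatibility`,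
stmt-Langlands-17534, verbatim). [cite: TaylorGaloisRepresentations2004, Conj. 7] -/
def PadicMemberCompatibility : Prop :=
  ∀ (K : Type) [Field K] [NumberField K] (n : ℕ) (hcpt : isCompact_glFiniteIntegralLevel n K), 0 < n →
    ∀ (π : CuspidalAutomorphicRepData n K hcpt), π.1.IsLAlgebraic → ∀ (ℓ : ℕ) [Fact ℓ.Prime] (ι : PadicAlgCl ℓ ≃+* ℂ)
      (ρ : FramedGaloisRep K (PadicAlgCl ℓ) n), ρ.toGaloisRep.IsIrreducible →
      (∀ᶠ v : HeightOneSpectrum (𝓞 K) in cofinite, SatakeFrobCompatibleAt ι π.1 ρ v) →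
      ∀ (v : HeightOneSpectrum (𝓞 K)) (hv : ((ℓ : ℕ) : 𝓞 K) ∈ v.asIdeal),
        (Literature.NumberTheory.PAdicHodge.fontainePstAdicCompletion v ℓ hv).IsDeRhamFramed (ρ.toLocal v) ∧
        ∀ (Rec : ReciprocityData K) (ℓ' : ℕ) [Fact ℓ'.Prime] (ι' : PadicAlgCl ℓ' ≃+* ℂ)
          (ρ' : FramedGaloisRep K (PadicAlgCl ℓ') n), ((ℓ' : ℕ) : 𝓞 K) ∉ v.asIdeal →
          ρ'.toGaloisRep.IsIrreducible →
          (∀ᶠ w : HeightOneSpectrum (𝓞 K) in cofinite, SatakeFrobCompatibleAt ι' π.1 ρ' w) →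
          LocalGlobalCompatibleAt Rec ι' π.1 ρ' v → LocalGlobalCompatibleAt Rec ι π.1 ρ v

/-- **L∤∀ — Taylor's Conj. 7 at every `v ∤ ℓ`, for EVERY reciprocity datum** (the `∀ Rec` form of
`PrimeSwitchSplit.CompatibilityAwayFromL`, stmt-Langlands-17417, forced by the 2026-08-17 re-type; text of the
published birth `Lines/birth_CompatibilityAwayFromLAll.lean`). [cite: TaylorGaloisRepresentations2004, Conj. 7] -/
def CompatibilityAwayFromLAll : Prop :=
  ∀ (K : Type) [Field K] [NumberField K] (Rec : ReciprocityData K) (n : ℕ)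
    (hcpt : isCompact_glFiniteIntegralLevel n K), 0 < n → ∀ (π : CuspidalAutomorphicRepData n K hcpt),
    π.1.IsLAlgebraic → ∀ (ℓ : ℕ) [Fact ℓ.Prime] (ι : PadicAlgCl ℓ ≃+* ℂ) (ρ : FramedGaloisRep K (PadicAlgCl ℓ) n),
    ρ.toGaloisRep.IsIrreducible →
      ((∀ᶠ v : HeightOneSpectrum (𝓞 K) in cofinite, ρ.IsUnramifiedAt v) ∧
        ∀ (v : HeightOneSpectrum (𝓞 K)) (hv : ((ℓ : ℕ) : 𝓞 K) ∈ v.asIdeal),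
          (Literature.NumberTheory.PAdicHodge.fontainePstAdicCompletion v ℓ hv).IsDeRhamFramed (ρ.toLocal v)) →
      (∀ᶠ v : HeightOneSpectrum (𝓞 K) in cofinite, SatakeFrobCompatibleAt ι π.1 ρ v) →
        ∀ v : HeightOneSpectrum (𝓞 K), ((ℓ : ℕ) : 𝓞 K) ∉ v.asIdeal → LocalGlobalCompatibleAt Rec ι π.1 ρ v

/-- **RD — the summit's non-vacuity conjunct** (= `WachComponentCensus.CanonicalReciprocityData`,
stmt-Langlands-17930). [cite: HarrisTaylorAMS2001, Thm. A] -/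
def ReciprocityDataNonempty : Prop :=
  ∀ (K : Type) [Field K] [NumberField K], Nonempty (ReciprocityData K)

/-- **U — uniqueness of the irreducible Satake avatar up to conjugacy** (= `PrimeSwitchSplit.AvatarConjugacy`,
stmt-Langlands-17844, verbatim; provable now). [cite: DeligneSerreASENS1974, Lemme 3.2] -/
def AvatarConjugacy : Prop :=
  ∀ (K : Type) [Field K] [NumberField K] (n : ℕ) (hcpt : isCompact_glFiniteIntegralLevel n K)
    (π : CuspidalAutomorphicRepData n K hcpt) (ℓ : ℕ) [Fact ℓ.Prime] (ι : PadicAlgCl ℓ ≃+* ℂ)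
    (ρ₀ ρ : FramedGaloisRep K (PadicAlgCl ℓ) n), ρ₀.toGaloisRep.IsIrreducible →
    (∀ᶠ v : HeightOneSpectrum (𝓞 K) in cofinite, SatakeFrobCompatibleAt ι π.1 ρ₀ v) →
    (∀ᶠ v : HeightOneSpectrum (𝓞 K) in cofinite, SatakeFrobCompatibleAt ι π.1 ρ v) → IsConjugate ρ₀ ρ

/-- **The summit from the six UNCUT leaves** (texts only; proof = `PrimeSwitchSplit.closes` rev 3 adapted to
`∀ 𝓡`, verbatim the published `ramifiedCoefficientSeed_sectorComplement_of_leaves` without its idle antecedent):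
`Nonempty (ReciprocityData F)` from RD; then for EVERY datum `Rec` a local–global helper (irreducible
Satake-compatible pairs are `Rec`-geometric and compatible at every finite place — at `v ∤ ℓ` by L∤∀, at
`v ∣ ℓ` through an auxiliary prime `ℓ' ∈ {2, 3}` below `v`: W⁺ at `ℓ'`, L∤∀ at `(ℓ', v)`, P(ii) switches back
to `ℓ`); (A) = W⁺ + helper + U; (B) = B_w + helper. [cite: BuzzardGeeLMS2014, Conj. 3.2.1 and Conj. 3.2.2]
[cite: TaylorGaloisRepresentations2004, Conj. 7] [cite: DeligneSerreASENS1974, Lemme 3.2] -/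
theorem langlands_of_leaves
    (hB : ∀ (K : Type) [Field K] [NumberField K] (n : ℕ) (hcpt : isCompact_glFiniteIntegralLevel n K),
      0 < n → ∀ (ℓ : ℕ) [Fact ℓ.Prime] (ι : PadicAlgCl ℓ ≃+* ℂ) (ρ : FramedGaloisRep K (PadicAlgCl ℓ) n),
      ρ.toGaloisRep.IsIrreducible →
        ((∀ᶠ v : HeightOneSpectrum (𝓞 K) in cofinite, ρ.IsUnramifiedAt v) ∧
          ∀ (v : HeightOneSpectrum (𝓞 K)) (hv : ((ℓ : ℕ) : 𝓞 K) ∈ v.asIdeal),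
            (Literature.NumberTheory.PAdicHodge.fontainePstAdicCompletion v ℓ hv).IsDeRhamFramed (ρ.toLocal v)) →
        ∃ π : CuspidalAutomorphicRepData n K hcpt, π.1.IsLAlgebraic ∧
          ∀ᶠ v : HeightOneSpectrum (𝓞 K) in cofinite, SatakeFrobCompatibleAt ι π.1 ρ v)
    (hW : SatakeAvatarExistence) (hP : PadicMemberCompatibility) (hA : CompatibilityAwayFromLAll)
    (hRD : ReciprocityDataNonempty) (hU : AvatarConjugacy) : _root_.Langlands := by
  intro F _ _
  refine ⟨hRD F, fun Rec n hn hcpt => ?_⟩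
  -- every finite place misses the prime 2 or the prime 3
  have hprime : ∀ v : HeightOneSpectrum (𝓞 F), ∃ (ℓ' : ℕ) (_ : Fact ℓ'.Prime), ((ℓ' : ℕ) : 𝓞 F) ∉ v.asIdeal := by
    intro v
    by_cases h2 : ((2 : ℕ) : 𝓞 F) ∈ v.asIdeal
    · refine ⟨3, ⟨Nat.prime_three⟩, fun h3 => v.isPrime.ne_top ((Ideal.eq_top_iff_one _).2 ?_)⟩
      have h := v.asIdeal.sub_mem h3 h2
      have h1 : ((3 : ℕ) : 𝓞 F) - ((2 : ℕ) : 𝓞 F) = 1 := by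
        push_cast; norm_num
      rwa [h1] at h
    · exact ⟨2, ⟨Nat.prime_two⟩, h2⟩
  -- the local–global helper for the datum `Rec` at hand
  have hLGC : ∀ (π : CuspidalAutomorphicRepData n F hcpt), π.1.IsLAlgebraic →
      ∀ (ℓ : ℕ) [Fact ℓ.Prime] (ι : PadicAlgCl ℓ ≃+* ℂ) (ρ : FramedGaloisRep F (PadicAlgCl ℓ) n),
        ρ.toGaloisRep.IsIrreducible →
        (∀ᶠ v : HeightOneSpectrum (𝓞 F) in cofinite, SatakeFrobCompatibleAt ι π.1 ρ v) →
        IsGeometricFramed Rec ρ ∧ ∀ v : HeightOneSpectrum (𝓞 F), LocalGlobalCompatibleAt Rec ι π.1 ρ v := by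
    intro π hL ℓ _ ι ρ hirr hρ
    have hgeo : (∀ᶠ v : HeightOneSpectrum (𝓞 F) in cofinite, ρ.IsUnramifiedAt v) ∧
        ∀ (v : HeightOneSpectrum (𝓞 F)) (hv : ((ℓ : ℕ) : 𝓞 F) ∈ v.asIdeal),
          (Literature.NumberTheory.PAdicHodge.fontainePstAdicCompletion v ℓ hv).IsDeRhamFramed (ρ.toLocal v) :=
      ⟨hρ.mono fun v ⟨_, _, hur, _⟩ => hur, fun v hv => (hP F n hcpt hn π hL ℓ ι ρ hirr hρ v hv).1⟩
    refine ⟨hgeo, fun v => ?_⟩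
    by_cases hv : ((ℓ : ℕ) : 𝓞 F) ∈ v.asIdeal
    · obtain ⟨ℓ', _, hℓ'⟩ := hprime v
      obtain ⟨ι'⟩ := PadicAlgCl.nonempty_ringEquiv_complex ℓ'
      obtain ⟨ρ', hirr', hρ'⟩ := hW F n hcpt hn π hL ℓ' ι'
      have hgeo' : (∀ᶠ w : HeightOneSpectrum (𝓞 F) in cofinite, ρ'.IsUnramifiedAt w) ∧
          ∀ (w : HeightOneSpectrum (𝓞 F)) (hw : ((ℓ' : ℕ) : 𝓞 F) ∈ w.asIdeal),
            (Literature.NumberTheory.PAdicHodge.fontainePstAdicCompletion w ℓ' hw).IsDeRhamFramed (ρ'.toLocal w) :=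
        ⟨hρ'.mono fun w ⟨_, _, hur, _⟩ => hur, fun w hw => (hP F n hcpt hn π hL ℓ' ι' ρ' hirr' hρ' w hw).1⟩
      exact (hP F n hcpt hn π hL ℓ ι ρ hirr hρ v hv).2 Rec ℓ' ι' ρ' hℓ' hirr' hρ'
        (hA F Rec n hcpt hn π hL ℓ' ι' ρ' hirr' hgeo' hρ' v hℓ')
    · exact hA F Rec n hcpt hn π hL ℓ ι ρ hirr hgeo hρ v hv
  refine ⟨?_, ?_⟩
  · -- (A) automorphic → Galois, with uniqueness up to conjugacy from U
    intro π hL ℓ _ ι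
    obtain ⟨ρ, hirr, hρ⟩ := hW F n hcpt hn π hL ℓ ι
    obtain ⟨hgeo, hloc⟩ := hLGC π hL ℓ ι ρ hirr hρ
    exact ⟨ρ, hirr, hgeo, ⟨hρ, hloc⟩, fun ρ' h' => hU F n hcpt π ℓ ι ρ ρ' hirr hρ h'.1⟩
  · -- (B) Galois → automorphic
    intro ℓ _ ι ρ hirr hgeo
    obtain ⟨π, hL, hρ⟩ := hB F n hcpt hn ℓ ι ρ hirr hgeo
    exact ⟨π, hL, hρ, (hLGC π hL ℓ ι ρ hirr hρ).2⟩

/-- **Glue of D_HT (PROVED, pure logic):** `B⁺_E → B⁻ → W⁺ → P → L∤∀ → RD → U → SectorComplement`.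
`Target` is consumed — fed to B⁺_E on the elliptic plane —, B_w is reassembled by excluded middle on the plane,
then `langlands_of_leaves`. [cite: BuzzardGeeLMS2014, Conj. 3.2.1 and Conj. 3.2.2]
[cite: FontaineMazurGeometric1995, Conj. 1] -/
theorem sectorComplement_of_pieces (hE : EllipticPlaneEntry) (hBoff : WeakAutomorphyOffEllipticPlane)
    (hW : SatakeAvatarExistence) (hP : PadicMemberCompatibility) (hA : CompatibilityAwayFromLAll)
    (hRD : ReciprocityDataNonempty) (hU : AvatarConjugacy) : SectorComplement := fun hX ↦
  langlands_of_leaves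
    (fun K _ _ n hcpt hn ℓ _ ι ρ hirr hgeo ↦ by
      by_cases hpl : OnEllipticTowerPlane K n ℓ ρ
      · exact hE hX K n hcpt hn ℓ ι ρ hirr hgeo hpl
      · exact hBoff K n hcpt hn ℓ ι ρ hirr hgeo hpl)
    hW hP hA hRD hU

/-- Control: WITHOUT the cut the six leaves give the summit outright and `Target` is idle — the shape of
every homonymous frame line (`Sketch_18275_r1_k1`, `Sketch_18745_r1_k1`, `leaves_MirrorPairReflection` minus
its own plane). [folklore] -/
theorem sectorComplement_of_uncut_leaves
    (hB : ∀ (K : Type) [Field K] [NumberField K] (n : ℕ) (hcpt : isCompact_glFiniteIntegralLevel n K),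
      0 < n → ∀ (ℓ : ℕ) [Fact ℓ.Prime] (ι : PadicAlgCl ℓ ≃+* ℂ) (ρ : FramedGaloisRep K (PadicAlgCl ℓ) n),
      ρ.toGaloisRep.IsIrreducible →
        ((∀ᶠ v : HeightOneSpectrum (𝓞 K) in cofinite, ρ.IsUnramifiedAt v) ∧
          ∀ (v : HeightOneSpectrum (𝓞 K)) (hv : ((ℓ : ℕ) : 𝓞 K) ∈ v.asIdeal),
            (Literature.NumberTheory.PAdicHodge.fontainePstAdicCompletion v ℓ hv).IsDeRhamFramed (ρ.toLocal v)) →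
        ∃ π : CuspidalAutomorphicRepData n K hcpt, π.1.IsLAlgebraic ∧
          ∀ᶠ v : HeightOneSpectrum (𝓞 K) in cofinite, SatakeFrobCompatibleAt ι π.1 ρ v)
    (hW : SatakeAvatarExistence) (hP : PadicMemberCompatibility) (hA : CompatibilityAwayFromLAll)
    (hRD : ReciprocityDataNonempty) (hU : AvatarConjugacy) : SectorComplement :=
  fun _hX ↦ langlands_of_leaves hB hW hP hA hRD hU

/-- … and the cut is EXACT: B_w is recovered from its two halves, so D_HT weakens nothing relative to the
summit's partition. [folklore] -/
theorem weakGeometricAutomorphy_of_cut (hX : Target) (hE : EllipticPlaneEntry)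
    (hBoff : WeakAutomorphyOffEllipticPlane) :
    ∀ (K : Type) [Field K] [NumberField K] (n : ℕ) (hcpt : isCompact_glFiniteIntegralLevel n K),
      0 < n → ∀ (ℓ : ℕ) [Fact ℓ.Prime] (ι : PadicAlgCl ℓ ≃+* ℂ) (ρ : FramedGaloisRep K (PadicAlgCl ℓ) n),
      ρ.toGaloisRep.IsIrreducible →
        ((∀ᶠ v : HeightOneSpectrum (𝓞 K) in cofinite, ρ.IsUnramifiedAt v) ∧
          ∀ (v : HeightOneSpectrum (𝓞 K)) (hv : ((ℓ : ℕ) : 𝓞 K) ∈ v.asIdeal),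
            (Literature.NumberTheory.PAdicHodge.fontainePstAdicCompletion v ℓ hv).IsDeRhamFramed (ρ.toLocal v)) →
        ∃ π : CuspidalAutomorphicRepData n K hcpt, π.1.IsLAlgebraic ∧
          ∀ᶠ v : HeightOneSpectrum (𝓞 K) in cofinite, SatakeFrobCompatibleAt ι π.1 ρ v := by
  intro K _ _ n hcpt hn ℓ _ ι ρ hirr hgeo
  by_cases hpl : OnEllipticTowerPlane K n ℓ ρ
  · exact hE hX K n hcpt hn ℓ ι ρ hirr hgeo hpl
  · exact hBoff K n hcpt hn ℓ ι ρ hirr hgeo hpl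

/-! ## §3 NEGATION — see `not_sectorComplement_iff` (§0): a counterexample = a PROOF of `Target` (the open
sector theorem) AND a disproof of the typed summit; nothing weaker. -/

/-- Non-vacuity of the elliptic plane's field clause at the bottom of the tower (`K = ℚ`, `m = 0`), so the cut
is not along an empty set of fields. [folklore] -/
example : ∃ m : ℕ, Nonempty (ℚ →+* CyclotomicField ((7 : ℕ+) ^ (m + 1)) ℚ) := ⟨0, ⟨algebraMap ℚ _⟩⟩

end Summit.Langlands.Langlands.Cruxes.Assembly.HeptagonalTowerCensus

end
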